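import Literature.Geometry.Riemannian.HamiltonCurvatureRatio
import Literature.Geometry.Riemannian.BonnetMyers
import Literature.Geometry.Riemannian.LipschitzSmoothing
import Literature.Geometry.Riemannian.LiQingShiPinchingProofs
import Literature.Geometry.Riemannian.ChangGurskyYangRegularity
import Literature.Geometry.Riemannian.RicciFlow
import HarnessLib

/-!
# Oscillation decay of the scalar curvature of a pinched Type-I Ricci flow
(helpers of stub `stub_roundnessRate` of line `margerin-cone-hamilton-rails`, crux
`EntropyRung.ChangGurskyYang`, item stmt-SmoothPoincare4-10834)

Step 4.B3 of STUB 4 (`stub_pinchedFlowConvergence` = Hamilton 1986, §5.2) of the line, SECOND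
HALF: Hamilton 1982, §17 (Lemma 17.4 ⇒ Cor. 17.5: `R_max − R_min → 0` at a rate) in unnormalised
clothes, by the argument of Hamilton's Thm. 15.1 (gradient bound + Myers). Along a Ricci flow on a
closed connected 4-manifold with the pinching `|W|² + 2|E|² ≤ K R^{2−τ}`, the Type-I bounds
`(T−t)R ≥ 1`, `K R^{−τ} ≤ 1/20` and the gradient decay `|∇R|² ≤ C₁(T−t)^{δ₁−3}` on `[t₀, T)`:
`(T−t)|R(x,t) − R(y,t)| ≤ 6π√(max C₁ 0)·(T−t)^{δ₁/2}` (`helper_roundnessOscillation`).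

## Proof (fact-free)

* `ricci_ge_of_tracelessRicciNormSq` — `Ric(w,w) ≥ (R/4 − |E|) g(w,w)` in dimension `4`: extend
  `w/|w|` to an orthonormal frame (`exists_isOrthonormalFrame_extend`), so that
  `(Ric(w,w)/|w|² − R/4)² = E₀₀² ≤ Σ E_{ab}² = |E|²` (`tracelessRicciNormSq_eq_…Frame_four`).
* `abs_sub_mul_sqrt_le_of_mfderiv_le` — on a compact connected manifold with `|df| ≤ A` and
  `Ric ≥ (n−1)k g`, `k > 0`: `|f(y) − f(x)|√k ≤ Aπ` — join `x` to `y` by a minimizing unit-speed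
  geodesic of length `ℓ` (Hopf–Rinow, `exists_isMinimizingUpTo_of_isGeodesicallyComplete`),
  `|f(y) − f(x)| ≤ Aℓ` (`abs_sub_le_mul_of_mfderiv_le`) and `ℓ√k ≤ π` (Myers,
  `length_mul_sqrt_le_pi_of_isMinimizingUpTo`).
* `helper_roundnessOscillation` — at a late time `t`, `h = T − t`: `|E|² ≤ (K/2)R^{−τ}R² ≤ R²/40`,
  so `Ric ≥ (R/4 − R/6)g ≥ g/(12h) = 3k g` with `k = 1/(36h)`; `|dR(w)| ≤ |∇R||w|`
  (`abs_mvfderiv_le_sqrt_gradSq_mul_sqrt`) with `|∇R| ≤ √(C₁' h^{δ₁−3})`; hence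
  `|R(x) − R(y)| ≤ 6√h·π·√C₁'·h^{(δ₁−3)/2}` and `h·|R(x) − R(y)| ≤ 6π√C₁' h^{δ₁/2}`.

## References

* R. S. Hamilton, *Three-manifolds with positive Ricci curvature*, J. Differential Geom. 17
  (1982) 255–306, §15 Thm. 15.1–15.2, §17 Lemma 17.4, Cor. 17.5. [Hamilton1982]
* S. B. Myers, *Riemannian manifolds with positive mean curvature*, Duke Math. J. 8 (1941)
  401–404. [Myers1941]
-/

noncomputable section

-- every `Summit.SmoothPoincare4.SmoothPoincare4.…` name repeats the summit = sub-problem segment (D-0017 layout)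
set_option linter.dupNamespace false

open Set Function Filter
open scoped Manifold ContDiff Topology

namespace Summit.SmoothPoincare4.SmoothPoincare4.Theorems.MargerinRails

open Literature.Geometry.Riemannian
open Literature.Geometry.Lorentzian Literature.Geometry.Lorentzian.PseudoRiemannianMetric

section Frame

variable {E : Type*} [NormedAddCommGroup E] [NormedSpace ℝ E] [FiniteDimensional ℝ E]
  {H : Type*} [TopologicalSpace H] {I : ModelWithCorners ℝ E H}
  {M : Type*} [TopologicalSpace M] [ChartedSpace H M] [IsManifold I ∞ M] {n : ℕ∞ω}
  (g : PseudoRiemannianMetric I n E (TangentSpace I : M → Type _)) [g.HasLeviCivita]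

/-- **The trace-free Ricci tensor controls the Ricci tensor from below** (dimension `4`):
`Ric(w, w) ≥ (R/4 − |E|)·g(w, w)` with `|E| = √(|E|²)` (Hamilton 1982, §15: "`R_ij ≥ εRg_ij`"
from the pinching; Huisken 1985, §5). For a unit `w`, extend it to an orthonormal frame `e` with
`e₀ = w`; then `(Ric(w,w) − R/4)² = E₀₀² ≤ Σ_{ab} E_{ab}² = |E|²`. [cite: Hamilton1982, §15, Thm. 15.1 (proof)] -/
theorem ricci_ge_of_tracelessRicciNormSq (hg : g.IsRiemannian) (hE : Module.finrank ℝ E = 4)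
    (x : M) (w : TangentSpace I x) :
    (g.scalarCurvature x / 4 - Real.sqrt (g.tracelessRicciNormSq x)) * g.val x w w ≤
      g.ricci x w w := by
  classical
  have hpos : ∀ v : TangentSpace I x, v ≠ 0 → 0 < g.val x v v := fun v hv ↦ hg x v hv
  -- unit vectors
  have hunit : ∀ u : TangentSpace I x, g.val x u u = 1 →
      g.scalarCurvature x / 4 - Real.sqrt (g.tracelessRicciNormSq x) ≤ g.ricci x u u := by
    intro u hu
    obtain ⟨e, he, he0⟩ := g.exists_isOrthonormalFrame_extend hpos hE (fun _ ↦ u) {0}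
      (fun _ _ ↦ hu) (fun i hi j hj hij ↦ absurd (hi.trans hj.symm) hij)
    have h0 : e 0 = u := he0 0 rfl
    have hsq : g.tracelessRicciFrame x e 0 0 ^ 2 ≤ g.tracelessRicciNormSq x := by
      rw [g.tracelessRicciNormSq_eq_tracelessRicciNormSqFrame_four hE he]
      unfold tracelessRicciNormSqFrame
      refine le_trans ?_ (Finset.single_le_sum
        (f := fun a ↦ ∑ b, g.tracelessRicciFrame x e a b ^ 2)
        (fun _ _ ↦ Finset.sum_nonneg fun _ _ ↦ sq_nonneg _) (Finset.mem_univ 0))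
      exact Finset.single_le_sum (f := fun b ↦ g.tracelessRicciFrame x e 0 b ^ 2)
        (fun _ _ ↦ sq_nonneg _) (Finset.mem_univ 0)
    have hval : g.tracelessRicciFrame x e 0 0 = g.ricci x u u - g.scalarCurvature x / 4 := by
      rw [tracelessRicciFrame_apply, h0, Fintype.card_fin, frameDelta_self]
      push_cast
      ring
    have habs : |g.ricci x u u - g.scalarCurvature x / 4| ≤
        Real.sqrt (g.tracelessRicciNormSq x) := by
      rw [← hval]; exact Real.abs_le_sqrt hsq
    linarith [(abs_le.1 habs).1]
  by_cases hw : w = 0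
  · subst hw; simp
  have hww : 0 < g.val x w w := hpos w hw
  set ℓ := Real.sqrt (g.val x w w) with hℓ
  have hℓpos : 0 < ℓ := Real.sqrt_pos.2 hww
  have hℓsq : ℓ ^ 2 = g.val x w w := Real.sq_sqrt hww.le
  set u : TangentSpace I x := ℓ⁻¹ • w with hu'
  have hu : g.val x u u = 1 := by
    have h1 : g.val x u u = ℓ⁻¹ * ℓ⁻¹ * g.val x w w := by
      rw [hu']
      simp only [map_smul, FunLike.coe_smul, Pi.smul_apply, smul_eq_mul]
      ring
    rw [h1, ← hℓsq]
    field_simp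
  have hwu : w = ℓ • u := by rw [hu', smul_smul, mul_inv_cancel₀ hℓpos.ne', one_smul]
  have hric : g.ricci x w w = ℓ ^ 2 * g.ricci x u u := by
    rw [hwu]
    simp only [map_smul, LinearMap.smul_apply, smul_eq_mul]
    ring
  rw [hric, ← hℓsq, mul_comm]
  exact mul_le_mul_of_nonneg_left (hunit u hu) (sq_nonneg ℓ)

end Frame

section Oscillation

variable {E : Type*} [NormedAddCommGroup E] [NormedSpace ℝ E] [FiniteDimensional ℝ E]
  [CompleteSpace E] {M : Type*} [TopologicalSpace M] [ChartedSpace E M] [IsManifold 𝓘(ℝ, E) ∞ M]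
  [T2Space M] [CompactSpace M] [ConnectedSpace M]
  (g : PseudoRiemannianMetric 𝓘(ℝ, E) ∞ E (TangentSpace 𝓘(ℝ, E) : M → Type _)) [g.HasLeviCivita]

/-- **Oscillation bound from a gradient bound and Myers' theorem** (the argument of Hamilton 1982,
Thm. 15.1 / Cor. 17.5): on a compact connected boundaryless manifold of dimension `≥ 2` with a
smooth Riemannian metric, if `|df_z(w)| ≤ A|w|_g` (`A ≥ 0`) and `Rc(w,w) ≥ (dim M − 1)k g(w,w)`,
`k > 0`, then `|f(y) − f(x)|·√k ≤ Aπ` for all `x, y`. Join `x` to `y` by a minimizing geodesic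
`γ_v|[0,1]` (Hopf–Rinow, `exists_isMinimizingUpTo_of_isGeodesicallyComplete`; compact ⇒ complete,
`hopfRinow_compact_geodesicallyComplete`) of length `ℓ = |v|`; along its unit-speed
reparametrisation `|f(y) − f(x)| ≤ Aℓ` (`abs_sub_le_mul_of_mfderiv_le`) and `ℓ√k ≤ π` (Myers,
`length_mul_sqrt_le_pi_of_isMinimizingUpTo`). [cite: Hamilton1982, §15, Thm. 15.1–15.2]
[cite: Myers1941] -/
theorem abs_sub_mul_sqrt_le_of_mfderiv_le (hg : g.IsRiemannian)
    (hdim : 2 ≤ Module.finrank ℝ E) {f : M → ℝ}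
    (hf : ∀ y, MDifferentiableAt 𝓘(ℝ, E) 𝓘(ℝ, ℝ) f y) {A : ℝ} (hA0 : 0 ≤ A)
    (hA : ∀ (y : M) (w : TangentSpace 𝓘(ℝ, E) y),
      |(show ℝ from mfderiv 𝓘(ℝ, E) 𝓘(ℝ, ℝ) f y w)| ≤ A * Real.sqrt (g.val y w w))
    {k : ℝ} (hk : 0 < k)
    (hRic : ∀ (x : M) (w : TangentSpace 𝓘(ℝ, E) x),
      ((Module.finrank ℝ E : ℝ) - 1) * k * g.val x w w ≤ g.leviCivita.ricci x w w)
    (x y : M) : |f y - f x| * Real.sqrt k ≤ A * Real.pi := by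
  have hLC := PseudoRiemannianMetric.isLeviCivita_leviCivita_holds (g := g)
  have hk1 : ((1 : ℕ∞) : ℕ∞ω) + 1 ≤ ∞ := by
    rw [show ((1 : ℕ∞) : ℕ∞ω) + 1 = 2 by norm_num]
    exact WithTop.coe_le_coe.2 le_top
  haveI : CovariantDerivative.ContMDiffCovariantDerivative g.leviCivita 1 :=
    ⟨g.isLocallyContMDiff_leviCivita_holds 1 hk1 univ isOpen_univ⟩
  haveI : CovariantDerivative.ContMDiffCovariantDerivative g.leviCivita ∞ :=
    ⟨g.isLocallyContMDiff_leviCivita_holds ⊤ (le_of_eq rfl) univ isOpen_univ⟩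
  have hc : IsGeodesicallyComplete g.leviCivita := hopfRinow_compact_geodesicallyComplete le_rfl hg
  have hAπ : 0 ≤ A * Real.pi := by positivity
  obtain ⟨v, hmin, hyv⟩ := exists_isMinimizingUpTo_of_isGeodesicallyComplete g le_rfl hg hc x y
  have hvv0 : 0 ≤ g.val x v v := by
    by_cases hv : v = 0
    · simp [hv]
    · exact (hg x v hv).le
  set ℓ := Real.sqrt (g.val x v v) with hℓ
  rcases (show 0 ≤ ℓ from Real.sqrt_nonneg _).eq_or_lt with hℓ0 | hℓpos
  · -- `y = x`
    have hv0 : v = 0 := by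
      by_contra hv
      have h2 : 0 < ℓ := Real.sqrt_pos.2 (hg x v hv)
      linarith
    have hyx : y = x := by
      rw [← hyv, hv0]
      exact riemannianExpMap_zero g x
    rw [hyx, sub_self, abs_zero, zero_mul]
    exact hAπ
  -- unit-speed reparametrisation `u = ℓ⁻¹ v`, minimizing up to `ℓ`, ending at `y`
  have hvv : g.val x v v = ℓ ^ 2 := (Real.sq_sqrt hvv0).symm
  set u : TangentSpace 𝓘(ℝ, E) x := ℓ⁻¹ • v with hu'
  have hu : g.val x u u = 1 := by
    have h1 : g.val x u u = ℓ⁻¹ * ℓ⁻¹ * g.val x v v := by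
      rw [hu']
      simp only [map_smul, FunLike.coe_smul, Pi.smul_apply, smul_eq_mul]
      ring
    rw [h1, hvv]
    field_simp
  have hminu : IsMinimizingUpTo g hg x u ℓ := by
    rw [hu', isMinimizingUpTo_smul_iff hg hc x v (inv_pos.2 hℓpos), inv_mul_cancel₀ hℓpos.ne']
    exact hmin
  have hγℓ : maximalGeodesic g.leviCivita x u ℓ = y := by
    rw [hu', maximalGeodesic_smul hc x v ℓ⁻¹ ℓ, inv_mul_cancel₀ hℓpos.ne', ← hyv]
    exact (expMap_eq_maximalGeodesic hc x v).symm
  -- the gradient bound along `γ_u`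
  have h1 : |f y - f x| ≤ A * ℓ := by
    have h := abs_sub_le_mul_of_mfderiv_le g hc hf hA x u hu hℓpos.le
    rwa [hγℓ] at h
  -- Myers: `ℓ √k ≤ π`
  obtain ⟨-, hgeo, hγ0, hγu⟩ := maximalGeodesic_of_isGeodesicallyComplete hc x u
  have hspeed : ∀ t, g.val (maximalGeodesic g.leviCivita x u t)
      (velocity 𝓘(ℝ, E) (maximalGeodesic g.leviCivita x u) t)
      (velocity 𝓘(ℝ, E) (maximalGeodesic g.leviCivita x u) t) = 1 := by
    intro t
    rw [g.val_velocity_eq_of_isGeodesicOn_of_isCompatible hLC.2 isOpen_univ Set.ordConnected_univ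
      hgeo (mem_univ t) (mem_univ 0), hγu]
    have h0 : maximalGeodesic g.leviCivita x u 0 = x := hγ0
    rw [h0]
    exact hu
  have hRic' : ∀ t ∈ Ioo 0 ℓ, ((Module.finrank ℝ E : ℝ) - 1) * k ≤
      g.leviCivita.ricci (maximalGeodesic g.leviCivita x u t)
        (velocity 𝓘(ℝ, E) (maximalGeodesic g.leviCivita x u) t)
        (velocity 𝓘(ℝ, E) (maximalGeodesic g.leviCivita x u) t) := by
    intro t _
    have h := hRic _ (velocity 𝓘(ℝ, E) (maximalGeodesic g.leviCivita x u) t)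
    rwa [hspeed t, mul_one] at h
  have hle := length_mul_sqrt_le_pi_of_isMinimizingUpTo g hg hdim hc x u hu hk hℓpos hminu hRic'
  calc |f y - f x| * Real.sqrt k ≤ A * ℓ * Real.sqrt k :=
        mul_le_mul_of_nonneg_right h1 (Real.sqrt_nonneg _)
    _ = A * (ℓ * Real.sqrt k) := by ring
    _ ≤ A * Real.pi := mul_le_mul_of_nonneg_left hle hA0

end Oscillation

/-! ## Dimension four: the oscillation of `R` along a pinched Type-I flow -/

/-- **HELPER — OSCILLATION DECAY `(T−t)(R_max − R_min) ≤ C(T−t)^{δ₁/2}`** (Hamilton 1982, §17,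
Lemma 17.4 ⇒ Cor. 17.5 in unnormalised clothes, via the argument of Thm. 15.1; registered helper of
stub `stub_roundnessRate`). Along a Ricci flow of Riemannian metrics on `[0, T)` on a closed
connected 4-manifold with the invariant pinching `m ≤ R`, `|W|² + 2|E|² ≤ K R^{2−τ}`, suppose on
`[t₀, T)`: `(T−t)R ≥ 1`, `K R^{−τ} ≤ 1/20`, and `|∇R|² ≤ C₁(T−t)^{δ₁−3}`. Then for
`t ∈ [t₀, T)` and all `x, y`: `(T−t)|R(x,t) − R(y,t)| ≤ 6π√(max C₁ 0)(T−t)^{δ₁/2}`. Proof, with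
`h = T − t`: `|E|² ≤ (K/2)R^{−τ}R² ≤ R²/40 ≤ (R/6)²`, so `Ric ≥ (R/4 − R/6)g ≥ g/(12h)`
(`ricci_ge_of_tracelessRicciNormSq`, `R ≥ 1/h`), i.e. `Ric ≥ 3k g`, `k = 1/(36h)`, `√k = 1/(6√h)`;
`|dR(w)| ≤ √(C₁' h^{δ₁−3})|w|` (`abs_mvfderiv_le_sqrt_gradSq_mul_sqrt`); so
`|R(x) − R(y)|/(6√h) ≤ π√C₁'√(h^{δ₁−3})` (`abs_sub_mul_sqrt_le_of_mfderiv_le`) and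
`h·√h·√(h^{δ₁−3}) = h^{δ₁/2}`. [cite: Hamilton1982, §17, Lemma 17.4 and Cor. 17.5; §15, Thm. 15.1] -/
theorem helper_roundnessOscillation :
    ∀ (M : Type) [TopologicalSpace M] [T2Space M] [SecondCountableTopology M]
      [ChartedSpace (EuclideanSpace ℝ (Fin 4)) M] [IsManifold (𝓡 4) ∞ M] [CompactSpace M]
      [ConnectedSpace M]
      (g : ℝ → PseudoRiemannianMetric (𝓡 4) ∞ (EuclideanSpace ℝ (Fin 4)) (TangentSpace (𝓡 4) : M → Type _))
      (cov : ℝ → CovariantDerivative (𝓡 4) (EuclideanSpace ℝ (Fin 4)) (TangentSpace (𝓡 4) : M → Type _))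
      (T m K τ t₀ C₁ δ₁ : ℝ), 0 < m →
      IsRicciFlow g cov (Ico 0 T) → (∀ t ∈ Ico 0 T, (g t).IsRiemannian) →
      (∀ t ∈ Ico 0 T, ∀ [(g t).HasLeviCivita] (x : M),
        m ≤ (g t).scalarCurvature x ∧
          (g t).weylNormSq x + 2 * (g t).tracelessRicciNormSq x ≤
            K * (g t).scalarCurvature x ^ (2 - τ)) →
      t₀ ∈ Ico 0 T →
      (∀ t ∈ Ico t₀ T, ∀ x : M, 1 ≤ (T - t) * (g t).scalarCurvatureWith (cov t) x ∧
        K * (g t).scalarCurvatureWith (cov t) x ^ (-τ) ≤ 1 / 20) →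
      (∀ t ∈ Ico t₀ T, ∀ x : M,
        (g t).gradSq (fun y ↦ (g t).scalarCurvatureWith (cov t) y) x ≤ C₁ * (T - t) ^ (δ₁ - 3)) →
      ∀ t ∈ Ico t₀ T, ∀ x y : M,
        (T - t) * |(g t).scalarCurvatureWith (cov t) x - (g t).scalarCurvatureWith (cov t) y| ≤
          6 * Real.pi * Real.sqrt (max C₁ 0) * (T - t) ^ (δ₁ / 2) := by
  intro M _ _ _ _ _ _ _ g cov T m K τ t₀ C₁ δ₁ hm hflow hRiem hpinch ht₀ htype hgrad t ht x y
  have ht' : t ∈ Ico 0 T := ⟨ht₀.1.trans ht.1, ht.2⟩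
  set h := T - t with hh
  have hh0 : 0 < h := sub_pos.2 ht.2
  haveI := (g t).hasLeviCivita
  have hg : (g t).IsRiemannian := hRiem t ht'
  have h2 : (2 : ℕ∞ω) ≤ ∞ := WithTop.coe_le_coe.mpr le_top
  have hLC := hflow.isLeviCivita t ht'
  have hric : ∀ z : M, (cov t).ricci z = (g t).ricci z := fun z ↦ hLC.ricci_eq_ricci h2 z
  have hscal : ∀ z : M, (g t).scalarCurvatureWith (cov t) z = (g t).scalarCurvature z := by
    intro z
    show (g t).trace z ((cov t).ricci z) = (g t).trace z ((g t).ricci z)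
    rw [hric z]
  set f : M → ℝ := fun z ↦ (g t).scalarCurvatureWith (cov t) z with hf
  -- the gradient bound `|df(w)| ≤ A |w|`, `A = √C₁' · √(h^{δ₁-3})`
  set C₁' := max C₁ 0 with hC₁'
  have hC₁'0 : 0 ≤ C₁' := le_max_right _ _
  set A := Real.sqrt C₁' * Real.sqrt (h ^ (δ₁ - 3)) with hA
  have hA0 : 0 ≤ A := by positivity
  have hfd : ∀ z, MDifferentiableAt (𝓡 4) 𝓘(ℝ, ℝ) f z := fun z ↦
    hLC.contMDiff_trace_ricci.mdifferentiableAt (by simp)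
  have hAf : ∀ (z : M) (w : TangentSpace (𝓡 4) z),
      |(show ℝ from mfderiv (𝓡 4) 𝓘(ℝ, ℝ) f z w)| ≤ A * Real.sqrt ((g t).val z w w) := by
    intro z w
    have h1 := abs_mvfderiv_le_sqrt_gradSq_mul_sqrt (g t) hg f z w
    have h2 : (g t).gradSq f z ≤ C₁' * h ^ (δ₁ - 3) :=
      (hgrad t ht z).trans (mul_le_mul_of_nonneg_right (le_max_left _ _)
        (Real.rpow_nonneg hh0.le _))
    have h3 : Real.sqrt ((g t).gradSq f z) ≤ A := by
      rw [hA, ← Real.sqrt_mul hC₁'0]; exact Real.sqrt_le_sqrt h2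
    exact h1.trans (mul_le_mul_of_nonneg_right h3 (Real.sqrt_nonneg _))
  -- the Ricci lower bound `Ric ≥ 3k g`, `k = 1/(36h)`
  set k : ℝ := 1 / (36 * h) with hk
  have hk0 : 0 < k := by positivity
  have hRic : ∀ (z : M) (w : TangentSpace (𝓡 4) z),
      ((Module.finrank ℝ (EuclideanSpace ℝ (Fin 4)) : ℝ) - 1) * k * (g t).val z w w ≤
        (g t).leviCivita.ricci z w w := by
    intro z w
    obtain ⟨h1R, hKR⟩ := htype t ht z
    set R := (g t).scalarCurvatureWith (cov t) z with hR
    have hR0 : 0 < R := by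
      by_contra hcon
      push Not at hcon
      nlinarith
    -- `|E|² ≤ R²/40`
    have hEsq : (g t).tracelessRicciNormSq z ≤ (R / 6) ^ 2 := by
      obtain ⟨-, -, hWnn, hp⟩ : m ≤ R ∧
          0 ≤ (g t).normSq z ((cov t).ricci z) - R ^ 2 / 4 ∧
          0 ≤ (g t).curvNormSqWith (cov t) z - 2 * (g t).normSq z ((cov t).ricci z) + R ^ 2 / 3 ∧
          ((g t).curvNormSqWith (cov t) z - 2 * (g t).normSq z ((cov t).ricci z) + R ^ 2 / 3) +
            2 * ((g t).normSq z ((cov t).ricci z) - R ^ 2 / 4) ≤ K * R ^ (2 - τ) := by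
        have hcurv : (g t).curvNormSqWith (cov t) z = (g t).curvNormSqWith (g t).leviCivita z :=
          (g t).curvNormSqWith_congr (hLC.curvature_eq_riemann h2 z)
        have hE := (g t).tracelessRicciNormSq_eq_normSq hg finrank_euclideanSpace_fin z
        have hW := (g t).weylNormSq_eq_curvNormSqWith hg finrank_euclideanSpace_fin z
        obtain ⟨hmz, hpz⟩ := hpinch t ht' z
        have hEnn := (g t).tracelessRicciNormSq_nonneg z
        have hWnn := (g t).weylNormSq_nonneg z
        rw [hR, hric, hscal, hcurv]
        refine ⟨hmz, ?_, ?_, ?_⟩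
        · rw [← hE]; exact hEnn
        · rw [← hW]; exact hWnn
        · rw [← hE, ← hW]; exact hpz
      have hE := (g t).tracelessRicciNormSq_eq_normSq hg finrank_euclideanSpace_fin z
      rw [← hric, ← hscal] at hE
      have hsplit : K * R ^ (2 - τ) = K * R ^ (-τ) * R ^ 2 := by
        rw [sub_eq_add_neg, Real.rpow_add hR0, Real.rpow_two]; ring
      rw [hE]
      nlinarith [mul_le_mul_of_nonneg_right hKR (sq_nonneg R)]
    have hsqrt : Real.sqrt ((g t).tracelessRicciNormSq z) ≤ R / 6 :=
      (Real.sqrt_le_left (by positivity)).2 hEsq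
    have hww : 0 ≤ (g t).val z w w := by
      by_cases hw : w = 0
      · simp [hw]
      · exact (hg z w hw).le
    have key := ricci_ge_of_tracelessRicciNormSq (g t) hg finrank_euclideanSpace_fin z w
    rw [← hscal] at key
    have hcoef : ((Module.finrank ℝ (EuclideanSpace ℝ (Fin 4)) : ℝ) - 1) * k ≤
        R / 4 - Real.sqrt ((g t).tracelessRicciNormSq z) := by
      rw [finrank_euclideanSpace_fin, hk]
      have h12 : (1 : ℝ) / (12 * h) ≤ R / 12 := by
        rw [div_le_div_iff₀ (by positivity) (by norm_num)]
        nlinarith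
      have : ((4 : ℕ) : ℝ) - 1 = 3 := by norm_num
      rw [this, show (3 : ℝ) * (1 / (36 * h)) = 1 / (12 * h) by field_simp; ring]
      linarith
    exact (mul_le_mul_of_nonneg_right hcoef hww).trans key
  -- Myers + the gradient bound
  have hosc := abs_sub_mul_sqrt_le_of_mfderiv_le (g t) hg
    (by rw [finrank_euclideanSpace_fin]; norm_num) hfd hA0 hAf hk0 hRic y x
  -- `√k = 1/(6√h)` and the power count `h √h √(h^{δ₁-3}) = h^{δ₁/2}`
  have hsh : 0 < Real.sqrt h := Real.sqrt_pos.2 hh0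
  have hsk : Real.sqrt k = (6 * Real.sqrt h)⁻¹ := by
    rw [hk, one_div, Real.sqrt_inv, Real.sqrt_mul (by norm_num), show (36 : ℝ) = 6 ^ 2 by norm_num,
      Real.sqrt_sq (by norm_num)]
  have hpow : h * Real.sqrt h * Real.sqrt (h ^ (δ₁ - 3)) = h ^ (δ₁ / 2) := by
    have e1 : Real.sqrt h = h ^ (1 / 2 : ℝ) := Real.sqrt_eq_rpow h
    have e2 : Real.sqrt (h ^ (δ₁ - 3)) = h ^ ((δ₁ - 3) * (1 / 2)) := by
      rw [Real.sqrt_eq_rpow, ← Real.rpow_mul hh0.le]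
    calc h * Real.sqrt h * Real.sqrt (h ^ (δ₁ - 3))
        = h ^ (1 : ℝ) * h ^ (1 / 2 : ℝ) * h ^ ((δ₁ - 3) * (1 / 2)) := by rw [Real.rpow_one, e1, e2]
      _ = h ^ (1 + 1 / 2 + (δ₁ - 3) * (1 / 2)) := by rw [Real.rpow_add hh0, Real.rpow_add hh0]
      _ = h ^ (δ₁ / 2) := by rw [show (1 + 1 / 2 + (δ₁ - 3) * (1 / 2) : ℝ) = δ₁ / 2 by ring]
  rw [hsk, ← div_eq_mul_inv, div_le_iff₀ (by positivity)] at hosc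
  calc h * |f x - f y| ≤ h * (A * Real.pi * (6 * Real.sqrt h)) :=
        mul_le_mul_of_nonneg_left hosc hh0.le
    _ = 6 * Real.pi * Real.sqrt C₁' * (h * Real.sqrt h * Real.sqrt (h ^ (δ₁ - 3))) := by
        rw [hA]; ring
    _ = 6 * Real.pi * Real.sqrt C₁' * h ^ (δ₁ / 2) := by rw [hpow]

end Summit.SmoothPoincare4.SmoothPoincare4.Theorems.MargerinRails

end
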